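import Summits.BirchSwinnertonDyer.BirchSwinnertonDyer.Theorems.GenusKolyvaginAtTwoGenusPrimitiveSupplyAtTwoConjugationTypeAtTwo
import HarnessLib

/-!
# Route `GenusKolyvaginAtTwo`, LINE 16_T / LINE 19 on the `Δ > 0` cruxes U⁺_T / L⁺_T (stmt-BirchSwinnertonDyer-23378 /
# 23379): complex conjugation is NEVER a regular involution of `E[2^{n+1}]` when `Δ(E) > 0`

Seat `bsd-line-gk2-p3` g15 (cell `bsd-f1-sign2`), `--supports stmt-BirchSwinnertonDyer-23379` (helper; closes nothing).
THEOREMS ONLY; BSD is not proved by any of this.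

WHY. The Δ > 0 lines of the pen (LINE 16_T `regular_frobenius_T`, LINE 19 `regular_plus_descent`) replace the
classical Kolyvagin primes (`Frob_ℓ = c₀`, complex conjugation) by REGULAR primes (`Frob_ℓ = h` with
`2^n(P + hP) ≠ 0` for some `P ∈ E[2^{n+1}]`), because on `Δ > 0` the `c₀`-primes are "lossy" («`(1+c₀)E[2^M] ≅ 2ℤ/2^M`»).
This file is the kernel form of that remark, the sharpness witness for the REGULAR hypothesis of
`RegularPlusDescent.regularEigenCyclic` / `free_of_regular` (sibling `…PosTRegularEigenCyclic`): for `Δ(E) > 0` and any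
complex conjugation `c₀ ∈ Γ_ℚ`, `2^n · (P + c₀P) = 0` for EVERY `P ∈ E[2^{n+1}]` — `c₀` acts trivially on `E[2]` (all
three `2`-division abscissae are real; tree `GenusKolySign.twoTorsion_smul_eq_of_Δ_pos`), and `2^n(P + c₀P) =
T + c₀T = 2T = 0` for the `2`-torsion point `T = 2^n P`. So no `c₀`-prime is regular on `Δ > 0`, and `E[2^{n+1}]` is
never free of rank one over `(ℤ/2^{n+1})[c₀]` there (contrast Q1 `CyclicTorsionOfNegDisc` on `Δ < 0`).

References: [GrossLMS1991] §3 (3.3); [SilvermanAEC2009] III.1 (real `2`-division points iff `Δ > 0`).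
-/

set_option autoImplicit false
set_option linter.dupNamespace false

noncomputable section

open scoped Classical

namespace Summit.BirchSwinnertonDyer.BirchSwinnertonDyer.Theorems.GenusExact.RegularPlusDescent

open WeierstrassCurve Field
open Literature.NumberTheory.EllipticCurves Literature.NumberTheory.GaloisRepresentations

/-- **On `Δ > 0`, complex conjugation is never regular**: `2^n · (P + c₀P) = 0` for every `P ∈ E[2^{n+1}]` and every
complex conjugation `c₀ ∈ Γ_ℚ` (`c₀` fixes `E[2]`, so `2^n(P + c₀P) = T + c₀T = 2T = 0` with `T = 2^nP ∈ E[2]`).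
[cite: GrossLMS1991, §3 (3.3)] [cite: SilvermanAEC2009, III.1] -/
theorem two_pow_smul_add_smul_eq_zero_of_Δ_pos (W : WeierstrassCurve ℚ) [W.IsElliptic] (hΔ : 0 < W.Δ)
    {c₀ : absoluteGaloisGroup ℚ} (hc₀ : IsComplexConjugation (Rat.castHom ℝ) c₀) (n : ℕ)
    (P : geomTorsion W ((2 ^ (n + 1) : ℕ) : ℤ)) : (2 : ℤ) ^ n • (P + c₀ • P) = 0 := by
  have hPn : (2 : ℤ) ^ (n + 1) • (P : geomPoints W) = 0 := by
    have h := (mem_geomTorsion_iff W _ (P : geomPoints W)).mp P.2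
    exact_mod_cast h
  -- the `2`-torsion point `T = 2^n P`
  have hT2 : (2 : ℤ) • ((2 : ℤ) ^ n • (P : geomPoints W)) = 0 := by rw [smul_smul, ← pow_succ', hPn]
  have hTmem : (2 : ℤ) ^ n • (P : geomPoints W) ∈ geomTorsion W 2 := (mem_geomTorsion_iff W 2 _).mpr hT2
  have hfix : c₀ • ((2 : ℤ) ^ n • (P : geomPoints W)) = (2 : ℤ) ^ n • (P : geomPoints W) := by
    have h := congrArg Subtype.val (GenusKolySign.twoTorsion_smul_eq_of_Δ_pos W hΔ hc₀ ⟨_, hTmem⟩)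
    rwa [AddSubgroup.torsionBy.coe_smul] at h
  apply Subtype.ext
  rw [AddSubgroupClass.coe_zsmul, AddSubgroup.coe_add, AddSubgroup.torsionBy.coe_smul, ZeroMemClass.coe_zero,
    smul_add, smul_comm ((2 : ℤ) ^ n) c₀ (P : geomPoints W), hfix, ← two_zsmul, hT2]

/-- **Corollary: on `Δ > 0` the hypothesis «regular» of `free_of_regular` / `regularEigenCyclic` is never met by a
complex conjugation** — there is no `P ∈ E[2^{n+1}]` with `2^n(P + c₀P) ≠ 0`. [cite: GrossLMS1991, §3 (3.3)] -/
theorem not_exists_regular_complexConjugation_of_Δ_pos (W : WeierstrassCurve ℚ) [W.IsElliptic] (hΔ : 0 < W.Δ)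
    {c₀ : absoluteGaloisGroup ℚ} (hc₀ : IsComplexConjugation (Rat.castHom ℝ) c₀) (n : ℕ) :
    ¬ ∃ P : geomTorsion W ((2 ^ (n + 1) : ℕ) : ℤ), (2 : ℤ) ^ n • (P + c₀ • P) ≠ 0 := by
  rintro ⟨P, hP⟩
  exact hP (two_pow_smul_add_smul_eq_zero_of_Δ_pos W hΔ hc₀ n P)

end Summit.BirchSwinnertonDyer.BirchSwinnertonDyer.Theorems.GenusExact.RegularPlusDescent

end
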